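import Mathlib
import Summits.Schanuel.Schanuel.Theses.RigidCore
import Summits.Schanuel.Schanuel.Theorems.AclSubsetLogFreeCore.Negative.LogFreeCoreObjects
import Summits.Schanuel.Schanuel.Theorems.AclSubsetLogFreeCore.Negative.ExpAclDefinability
import Summits.Schanuel.Schanuel.Theorems.AclSubsetLogFreeCore.Negative.LogFreeCoreCountable
import Literature.NumberTheory.Transcendental.GammaIsoTwisted
import Literature.NumberTheory.Transcendental.ZilberFieldQuasiminimalProps
import Literature.ModelTheory.Quasiminimal.PregeometryStructures

/-!
# Skeleton line `points-not-automorphisms` for crux `AclSubsetLogFreeCore` (stmt-Schanuel-0968)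

Route `RigidCore`, sub-problem `Schanuel`; crux (A):
`Summit.Schanuel.Schanuel.Theses.RigidCore.AclSubsetLogFreeCore` = `acl^{ℂ_exp}(∅) ⊆ C_EA`
(every element of a FINITE `∅`-definable subset of `(ℂ, +, ·, exp)` lies in the log-free core
`C_EA = logFreeCore`, the smallest `exp`-closed relatively algebraically closed subfield containing
`2πi`).  Crux-plan skeleton (planner `cruxplan-stmt-Schanuel-0968-points-not-automorphisms`): five
registered stubs `stub_*` (sorried), the sorry-free composition `composition`, and the skeleton
theorem `AclSubsetLogFreeCore_of` whose type is LITERALLY the route decl (the only theorem of this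
file concluding the crux by name; it is `aclSubsetLogFreeCore_iff.mpr (composition stub_… …)`,
`aclSubsetLogFreeCore_iff` being the disprover's `Iff.rfl` unbundling, landed in
`Theorems/AclSubsetLogFreeCore/Negative/LogFreeCoreObjects.lean`).

## The line in one paragraph — "points, not automorphisms", lifted to full first-order (A) by Karp

Idea card (`Ideas/points-not-automorphisms.md`): a second solution of a formula satisfied by
`a ∉ C_EA` needs no automorphism of `ℂ_exp` — other E-POINTS `(x, eˣ)` of the `C_EA`-locus of (a
hull of) `a` do.  For positive-existential formulas this is literal (the card's first lemma,
`CoreUnaryWitnessesInfinite`, recorded below as a named target); for ARBITRARY first-order formulas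
the points must be fed into a back-and-forth game.  The tree has exactly the engine: Bays–Kirby's
Karp system of Γ-isomorphisms between STRONG finitely generated Γ-subfields over a base
(`GammaField.IsGammaIso`, `…IsGammaIsoTw`, `…IsStrong`, `FirstOrder.Language.IsBackAndForth`,
`realize_iff_of_isBackAndForth` — the proof of BK 2018 Thm 1.5 in `ZilberFieldQuasiminimalProps`).
Bays–Kirby run it over the Γ-CLOSED base `ecl ∅ ⊋ C_EA`, inside which nothing moves; this line runs
it over the NON-closed base `C_EA` itself:

* states (`CoreState`) are twisted Γ-isomorphisms `c ↦ c'` over a KUMMER-INTEGRAL E-automorphism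
  `σ` of the core (`IsCoreTwist`) between tuples generating strong extensions of the core — twists
  are necessary: over the core fixed POINTWISE a branch of `log 2` is rigid (all `2^{1/m} ∈ C_EA`
  are fixed, so `exp (a/m)` pins the branch; this is the index-2 Kummer phenomenon of
  `Disproof.lean §7 not_branchIndiscernibility` in the limit), and a twist whose Kummer characters
  are not integral admits no partner for `d = log t`, `t ∈ C_EA`;
* `stub_coreKarp` (S1, provable now, M): core states form a back-and-forth family for `L_exp`
  GRANTED the one-point extension property — the twisted port of the tree's
  `GammaField.isBackAndForth_gammaIso_of_extension` (term values realised by extension steps,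
  relations with `ℚ`-coefficients transported along `σ`, back = forth for the inverse state);
* `stub_coreExtension` (S2a, provable now, M — the hull dichotomy): every core state extends over
  any new element `d` GRANTED saturation over the core — the twisted port of the tree's
  `GammaField.IsGammaIso.exists_extension_of_ccp`: the `δ = 1` case is the countable closure
  property (tree, proved; the core is countable, `Negative.countable_logFreeCore`), the `δ = 0` case
  is handed to S2b;
* `stub_coreSaturation` (S2b, OPEN — `ℵ₀`-saturation of `ℂ_exp` OVER THE CORE for Γ-algebraic
  strong extensions, twisted; Bays–Kirby Def. 5.14 / Prop. 11.2 with the Γ-closed base replaced by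
  the core): algebraic steps are in the tree (`IsGammaIsoTw.exists_append_single_of_mem_acl`, no
  closedness), logarithmic steps `d = log t` are exactly where Kummer-integrality of the twist
  (`t ∈ C_EA`) and strongness (`t ∉ C_EA`) replace the closedness hypothesis of the tree's
  `IsGammaIsoTw.exists_append_single_of_exp_mem_acl`, and genuinely new loci need GENERIC STRONG
  E-POINTS over `ℚ(C_EA, c', exp …)` — exponential-algebraic-closedness strength; plausibly a
  consequence of Zilber's conjecture, unconditional only in special sectors;
* `stub_corePoints` (S3, OPEN in general — THE LEVER): granted strongness of the core, every
  `a ∉ C_EA` has, for every finite `X`, a core state `e ↦ e'` with `e 0 = a`, `e' 0 ∉ X`: the hull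
  locus of `a` over the core has dimension `≥ 1` and its E-points generic over the countable core
  are not confined to a finite set (rank one, Kummer-generic loci such as the fixed points of `exp`
  or `z e^z = 1`: Hadamard/Pólya two-frequency theorem + genericity from strongness, provable now
  modulo S4 — target `RankOnePartners` below; logs of core elements need the Kummer room of
  `Aut_E(C_EA)`, arithmetic of the core);
* `stub_coreStrong` (S4, OPEN, arithmetic): `C_EA ◁ ℂ_exp` — Schanuel's conjecture OVER the core
  (`δ(x̄/C_EA) ≥ 0`), half of SC by additivity (`Schanuel ⟺ SchanuelOnLogFreeCore ∧ S4`, ideator's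
  `SchanuelSplitsOverCore`); needed because states must be strong and the empty state is the core.

Composition (`composition`, sorry-free, ~20 lines): let `a ∈ S`, `S` finite and `∅`-definable by
`φ`; if `a ∉ C_EA`, S3 (fed by S4) gives a core state `e ↦ e'` with `e 0 = a`, `e' 0 ∉ S`; by S1
(fed by S2a, itself fed by S2b) core states are a back-and-forth family for the valuations `_ ↦ a`,
`_ ↦ e' 0`, so by Karp's lemma `φ(a) ↔ φ(e' 0)`, i.e. `e' 0 ∈ S` — contradiction.  The shape is
Bays–Kirby's own (Karp ← extension ← saturation), transplanted from the closed base `ecl ∅` to the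
core, with the automorphisms of `ecl ∅` of the sibling EAC line replaced by E-points over the core.

## Disproof used (`Cruxes/AclSubsetLogFreeCore/Disproof.lean`, cdisprove gen 2, + landed `Negative/`)

* `aclSubsetLogFreeCore_false_without_finite` (landed, `LogFreeCoreCountable`): FINITENESS of `S`
  is used in `composition` exactly once — `X := S` in S3 (a finite set to avoid).
* `aclSubsetLogFreeCore_false_with_params_univ/real/one_real_param` (landed): PARAMETER-FREENESS
  is used in `composition` — `Set.empty_definable_iff` produces a formula with NO constants, and
  Karp transfers only `L_exp`-formulas (a real parameter `r` would have to be covered by the state,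
  i.e. moved to a partner `r'` with `r ↦ r'`, which is false for `v = v' = r ∉ C_EA`-rigid data).
* `aclSubsetLogFreeCore_false_without_expClosed`, `…_without_period_and_exp` (landed,
  `ExpAclDefinability`): honoured inside S3/S2b — the base of the Γ-calculus is `fieldOf coreΛ =
  ℚ(C_EA ∪ exp C_EA)`, and the absorption of "accidents" (a partner forced to be algebraic over core
  data lies IN the core) uses that `C_EA` is `exp`-closed and relatively algebraically closed and
  contains `2πi` (kernel of the twists: `σ(2πi) = ±2πi`).
* §7 `not_branchIndiscernibility` (Disproof.lean, not landed): the reason states are TWISTED and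
  twists Kummer-integral — partners of `ln 2` are `ln 2 + 4πik` (even shifts only), never
  `ln 2 + 2πi`; no stub asserts indiscernibility of branches.
* §5 `crux_iff_expDcl` (Disproof.lean): not needed — Karp handles `acl` directly (finite `S`), no
  reduction to `dcl`.
* `ledger negatives --problem Schanuel`: 2 entries (PolarPhantoms), unrelated; no stub is an
  instance of a refuted statement.

Everything outside the five `stub_*` theorems is sorry-free.
-/

noncomputable section

set_option linter.dupNamespace false

open Set FirstOrder FirstOrder.Language
open Literature.ModelTheory.ExponentialFields
open Literature.NumberTheory.Transcendental
open Literature.NumberTheory.Transcendental.GammaField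
open Summit.Schanuel.Schanuel.Theorems.AclSubsetLogFreeCore.Negative

namespace Summit.Schanuel.Schanuel.Cruxes.AclSubsetLogFreeCore.PointsNotAutomorphisms

/-! ### §0 Vocabulary of the line (over existing declarations) -/

/-- The log-free core `C_EA` as a `ℚ`-subspace of `ℂ` — the BASE of the Γ-field calculus of this
line (Bays–Kirby's `K`; here NOT Γ-closed).  Verbatim the ideator's `SchanuelOverLogFreeCore` base. -/
def coreΛ : Submodule ℚ ℂ :=
  Subalgebra.toSubmodule (logFreeCore).toSubalgebra

/-- Membership in `coreΛ` is membership in the core. -/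
theorem mem_coreΛ {x : ℂ} : x ∈ coreΛ ↔ x ∈ logFreeCore := by
  simp [coreΛ]

/-- **Kummer-integral base isomorphisms.**  `σ : ℚ(C_EA, exp C_EA) ≃ ℚ(C_EA, exp C_EA)` transports,
for every logarithm `d` of an element `eᵈ ∈ C_EA` of the core, the coherent system of roots
`(e^{d/m})_m ⊆ C_EA` to the coherent system of an ACTUAL logarithm `d'`:
`σ (e^{d/m}) = e^{d'/m}` for all `m ≥ 1`.  (Automatic for `d ∈ C_EA`; for `d = ln 2` it says the
Kummer character of `σ` on `2^{1/∞}` is an integer — the condition under which the forth step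
`d = log t` of the game has a partner.  `id` and complex conjugation qualify.) -/
def IsKummerIntegral (σ : fieldOf coreΛ ≃+* fieldOf coreΛ) : Prop :=
  ∀ d : ℂ, Complex.exp d ∈ logFreeCore → ∃ d' : ℂ, ∀ m : ℕ, 0 < m →
    ∀ h : Complex.exp (d / m) ∈ fieldOf coreΛ, (σ ⟨Complex.exp (d / m), h⟩ : ℂ) = Complex.exp (d' / m)

/-- **Admissible twists of the core**: E-field automorphisms of the base Γ-field of the core
(`IsEBaseIso`: `σ(C_EA) = C_EA`, `σ ∘ exp = exp ∘ σ` on `C_EA`) which are Kummer-integral in both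
directions (so that the class of states is closed under inversion by definition). -/
def IsCoreTwist (σ : fieldOf coreΛ ≃+* fieldOf coreΛ) : Prop :=
  IsEBaseIso coreΛ coreΛ σ ∧ IsKummerIntegral σ ∧ IsKummerIntegral σ.symm

/-- The identity is an admissible twist (so the notion of core state is not vacuous: modulo
strongness, `c ↦ c` over `id` is a state). -/
theorem isCoreTwist_refl : IsCoreTwist (RingEquiv.refl (fieldOf coreΛ)) := by
  refine ⟨IsEBaseIso.refl coreΛ, fun d _ => ⟨d, fun m _ h => rfl⟩, fun d _ => ⟨d, fun m _ h => rfl⟩⟩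

/-- **Core states** of the back-and-forth game, relative to parameter valuations `v, v'` and
variable tuples `xs, ys` (the shape of the tree's `isBackAndForth_gammaIso_of_extension`): a twisted
Γ-isomorphism `c ↦ c'` over an admissible twist `σ` of the core (`IsGammaIsoTw σ c c'`: the ideal
of relations of `(c', exp (c'/M!))` over `ℚ(C_EA, exp C_EA)` is the `σ`-transport of that of
`(c, exp (c/M!))`, every level `M`), both tuples generating STRONG extensions of the core
(`C_EA + ℚc ◁ ℂ_exp`, `C_EA + ℚc' ◁ ℂ_exp`, Bays–Kirby Def. 4.3), whose coordinates cover the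
valuations.  The twist is existentially quantified per state (only its existence matters for Karp). -/
def CoreState {α : Type} (v v' : α → ℂ) (n : ℕ) (xs ys : Fin n → ℂ) : Prop :=
  ∃ (σ : fieldOf coreΛ ≃+* fieldOf coreΛ) (N : ℕ) (c c' : Fin N → ℂ),
    IsCoreTwist σ ∧ IsGammaIsoTw σ c c' ∧
    IsStrong (coreΛ ⊔ Submodule.span ℚ (range c)) ∧ IsStrong (coreΛ ⊔ Submodule.span ℚ (range c')) ∧
    (∀ i, ∃ j, c j = v i ∧ c' j = v' i) ∧ (∀ i, ∃ j, c j = xs i ∧ c' j = ys i)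

/-! ### §1 The five stub statements (precise `Prop`s; the registered stubs are `stub_*` in §2) -/

/-- **S2b — `ℵ₀`-saturation of `ℂ_exp` OVER THE CORE for Γ-algebraic strong extensions
(twisted).**  The shape is Bays–Kirby's Def. 5.14 / Prop. 11.2 as rendered in the tree
(`BaysKirby2018_prop_11_2`, hypothesis `hsat` of `GammaField.IsGammaIso.exists_extension_of_ccp`),
with the Γ-closed base replaced by the core and a twist allowed: given a core state `c ↦ c'` over
`σ` and a Γ-ALGEBRAIC strong extension `e` of the left side (`δ(e / C_EA + ℚc) = 0`,
`C_EA + ℚ(c, e) ◁ ℂ_exp`), the extension is realised on the right — there is a partner `e'` with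
`(c, e) ↦ (c', e')` a core state (the twist may be re-chosen).  Its content, step by step along a
normalised basis of `e` (Bays–Kirby Prop. 3.22): ALGEBRAIC steps are the tree's twisted algebraic
step `IsGammaIsoTw.exists_append_single_of_mem_acl` (no closedness needed); LOGARITHMIC steps
`d = log t` — the tree's `IsGammaIsoTw.exists_append_single_of_exp_mem_acl` needs a Γ-CLOSED base,
and over the core it is exactly where Kummer-integrality of the twist (`t ∈ C_EA`) and strongness
of the states (`t ∉ C_EA`) must replace closedness (new lemma, plausibly provable); GENUINELY NEW
loci (rank `≥ 1` Γ-algebraic, not of log type): existence of a generic strong E-point of the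
transported free rotund locus over the countable field `ℚ(C_EA, c', exp …)` —
exponential-algebraic-closedness strength (Zilber's EAC for `ℂ_exp` is open; BK's generic strong
Γ-closedness `IsGenericallyStronglyGammaClosedOver` is proved in the tree only over Γ-closed bases
and FROM EAC).  OPEN; plausibly a consequence of Zilber's conjecture (homogeneity of `𝔹` over
`C_EA + f.g.` strong partial E-subfields — KMO 2012 §3.5, tree `KMO2012_automorphismExtension`, is
the f.g.-over-`SK` case; the passage to the countably generated core is not in print).  Size: XL. -/
def CoreSaturation : Prop :=
  ∀ (σ : fieldOf coreΛ ≃+* fieldOf coreΛ) (N k : ℕ) (c c' : Fin N → ℂ) (e : Fin k → ℂ),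
    IsCoreTwist σ → IsGammaIsoTw σ c c' →
    IsStrong (coreΛ ⊔ Submodule.span ℚ (range c)) → IsStrong (coreΛ ⊔ Submodule.span ℚ (range c')) →
    predim (coreΛ ⊔ Submodule.span ℚ (range c)) (Submodule.span ℚ (range e)) = 0 →
    IsStrong (coreΛ ⊔ Submodule.span ℚ (range (Fin.append c e))) →
    ∃ (σ' : fieldOf coreΛ ≃+* fieldOf coreΛ) (e' : Fin k → ℂ),
      IsCoreTwist σ' ∧ IsGammaIsoTw σ' (Fin.append c e) (Fin.append c' e') ∧
      IsStrong (coreΛ ⊔ Submodule.span ℚ (range (Fin.append c' e')))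

/-- **S2a — one-point extension of core states** (the `forth` of the game), the conclusion of the
hull dichotomy.  Every core state `c ↦ c'` extends over every prescribed new element `d` on the
left: there are `e ∋ d` (as `e 0`) and a partner `e'` with `(c, e) ↦ (c', e')` again a core state.
PROVABLE NOW from `CoreSaturation` (the registered stub is the implication
`stub_coreExtension : CoreSaturation → CoreExtension`), as the twisted port of the tree's
`GammaField.IsGammaIso.exists_extension_of_ccp` (any countable base): minimise `δ(·/C_EA + ℚc)`
over finitely generated extensions containing `d` (`IsStrong.exists_forall_predim_le`); value `1`:
`d` is generic and `C_EA + ℚ(c, d) ◁ ℂ_exp`, partner = any `d'` outside the countable Γ-closed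
`ecl (C_EA ∪ c')` (countable closure property `hasCountableClosureProperty_complex_holds`, the core
is countable `Negative.countable_logFreeCore`, Lemma 4.13 `IsStrong.sup_span_singleton`, and the
twisted generic step — same-field form of `IsGammaIsoTw₂.append_singleton_of_not_mem`); value `0`:
the extension is Γ-algebraic and strong, and `CoreSaturation` realises it.  Size: M. -/
def CoreExtension : Prop :=
  ∀ (σ : fieldOf coreΛ ≃+* fieldOf coreΛ) (N : ℕ) (c c' : Fin N → ℂ),
    IsCoreTwist σ → IsGammaIsoTw σ c c' →
    IsStrong (coreΛ ⊔ Submodule.span ℚ (range c)) → IsStrong (coreΛ ⊔ Submodule.span ℚ (range c')) →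
    ∀ d : ℂ, ∃ (σ' : fieldOf coreΛ ≃+* fieldOf coreΛ) (k : ℕ) (e e' : Fin (k + 1) → ℂ),
      e 0 = d ∧ IsCoreTwist σ' ∧ IsGammaIsoTw σ' (Fin.append c e) (Fin.append c' e') ∧
      IsStrong (coreΛ ⊔ Submodule.span ℚ (range (Fin.append c e))) ∧
      IsStrong (coreΛ ⊔ Submodule.span ℚ (range (Fin.append c' e')))

/-- **S1 — Karp assembly for core states (provable now).**  Granted the one-point extension
property, core states form a back-and-forth family for `L_exp = ⟨+, ·, −, 0, 1, exp⟩` over any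
pair of parameter valuations: related tuples satisfy the same atomic formulas (values of terms are
captured by extension steps; the defining relations `X = Y + Z`, `X = Y·Z`, `X = exp Y`, … have
rational coefficients, fixed by every twist, and transfer along `IsGammaIsoTw` at level `0`;
equalities transfer by `IsGammaIsoTw.apply_eq_iff`), forth is the extension property, back is
forth for the inverse state (`IsCoreTwist` is symmetric, `IsGammaIsoTw.symm`).  The twisted port of
the tree's `GammaField.exists_state_realize_term_of_extension` /
`GammaField.isBackAndForth_gammaIso_of_extension`.  Size: M. -/
def CoreKarp : Prop :=
  CoreExtension → ∀ (α : Type) (v v' : α → ℂ), Language.expRing.IsBackAndForth v v' (CoreState v v')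

/-- **S3 — the points lever: non-core points have many core-conjugates.**  Granted that the core is
strong in `ℂ_exp`, every `a ∉ C_EA` sits (as `e 0`) in a tuple `e` generating a strong extension of
the core which has, for every FINITE set `X`, a partner `e'` under some admissible twist with
`e' 0 ∉ X`.  Mechanism: `e` = generators of the hull of `a` over the core (exists because the core is
strong: `IsStrong.exists_forall_predim_le`); the hull locus over `ℚ(C_EA, exp C_EA)` has dimension
`≥ 1` because `a ∉ C_EA` and the core is relatively algebraically closed and `exp`-closed (an
"accident" making `a` algebraic over core data puts `a` IN the core — absorption); its E-points
generic over the countable core realise the same Γ-type (twisted by the Galois/Kummer action where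
the level data split).  Rank one, Kummer-generic loci (`F(x, y) = 0` with all `F(x, y^{M!})`
irreducible over the algebraically closed field `C_EA`, e.g. fixed points of `exp`, `z e^z = 1`):
partners = the other zeros of `F(z, e^z)` outside `C_EA` (Hadamard/Pólya two frequencies;
genericity is automatic on a curve) — the target `RankOnePartners` below, provable now modulo S4
and `PolyaTwoFrequencies`; branches of `log t`, `t ∈ C_EA`: partners `log t + 4πik` need a twist
acting on `t^{1/∞}` by the even integer `2k` and extending to an E-automorphism of the core
(Kummer room in `Aut_E(C_EA)` — arithmetic of the core, (R)-type); general rank: EAC-type existence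
of generic E-points on the hull locus.  OPEN in general.  Size: XL / open; the hardest stub. -/
def CorePoints : Prop :=
  IsStrong coreΛ → ∀ a : ℂ, a ∉ logFreeCore → ∀ X : Set ℂ, X.Finite →
    ∃ (σ : fieldOf coreΛ ≃+* fieldOf coreΛ) (k : ℕ) (e e' : Fin (k + 1) → ℂ),
      e 0 = a ∧ e' 0 ∉ X ∧ IsCoreTwist σ ∧ IsGammaIsoTw σ e e' ∧
      IsStrong (coreΛ ⊔ Submodule.span ℚ (range e)) ∧ IsStrong (coreΛ ⊔ Submodule.span ℚ (range e'))

/-- **S4 — Schanuel's conjecture OVER the core (`C_EA ◁ ℂ_exp`).**  Every finitely generated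
extension of the core inside `ℂ_exp` has non-negative predimension:
`td(x̄, e^{x̄} / C_EA) ≥ ldim_ℚ(x̄ / C_EA)` (Bays–Kirby Def. 4.3).  Follows from Schanuel's
conjecture (the core is built from `2πi` by zero-defect steps: `exp` of old elements and algebraic
elements), and conversely `Schanuel ⟺ RigidCore.SchanuelOnLogFreeCore ∧ CoreStrong` (additivity of
`δ`; ideator's `SchanuelSplitsOverCore`).  The arithmetic input of the line; OPEN (e.g. it contains
"`log 2 ∉ C_EA + ℚ·(…) ⇒ log 2` transcendental over `C_EA ∋ π`").  Verbatim the ideator's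
`SchanuelOverLogFreeCore`.  Size: open. -/
def CoreStrong : Prop :=
  IsStrong coreΛ

/-! ### §2 The registered stubs

Each registered stub `stub_X` is stated with its FULL signature (so that the signature recorded on
the ledger is the mathematics, not a name); it is syntactically the body of the `def X : Prop` of §1
(Lean re-checks the identification definitionally at `AclSubsetLogFreeCore_of`). -/

/-- **stub_coreKarp** (S1; provable now, size M): `CoreKarp` — Karp assembly for core states. -/
theorem stub_coreKarp :
    CoreExtension → ∀ (α : Type) (v v' : α → ℂ),
      Language.expRing.IsBackAndForth v v' (CoreState v v') := by
  sorry

/-- **stub_coreExtension** (S2a; provable now, size M — the hull dichotomy): `CoreSaturation →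
CoreExtension`. -/
theorem stub_coreExtension :
    CoreSaturation →
    ∀ (σ : fieldOf coreΛ ≃+* fieldOf coreΛ) (N : ℕ) (c c' : Fin N → ℂ),
      IsCoreTwist σ → IsGammaIsoTw σ c c' →
      IsStrong (coreΛ ⊔ Submodule.span ℚ (range c)) → IsStrong (coreΛ ⊔ Submodule.span ℚ (range c')) →
      ∀ d : ℂ, ∃ (σ' : fieldOf coreΛ ≃+* fieldOf coreΛ) (k : ℕ) (e e' : Fin (k + 1) → ℂ),
        e 0 = d ∧ IsCoreTwist σ' ∧ IsGammaIsoTw σ' (Fin.append c e) (Fin.append c' e') ∧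
        IsStrong (coreΛ ⊔ Submodule.span ℚ (range (Fin.append c e))) ∧
        IsStrong (coreΛ ⊔ Submodule.span ℚ (range (Fin.append c' e'))) := by
  sorry

/-- **stub_coreSaturation** (S2b; open — `ℵ₀`-saturation of `ℂ_exp` over the core, twisted; EAC
strength + arithmetic of logarithms of core elements): `CoreSaturation`. -/
theorem stub_coreSaturation :
    ∀ (σ : fieldOf coreΛ ≃+* fieldOf coreΛ) (N k : ℕ) (c c' : Fin N → ℂ) (e : Fin k → ℂ),
      IsCoreTwist σ → IsGammaIsoTw σ c c' →
      IsStrong (coreΛ ⊔ Submodule.span ℚ (range c)) → IsStrong (coreΛ ⊔ Submodule.span ℚ (range c')) →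
      predim (coreΛ ⊔ Submodule.span ℚ (range c)) (Submodule.span ℚ (range e)) = 0 →
      IsStrong (coreΛ ⊔ Submodule.span ℚ (range (Fin.append c e))) →
      ∃ (σ' : fieldOf coreΛ ≃+* fieldOf coreΛ) (e' : Fin k → ℂ),
        IsCoreTwist σ' ∧ IsGammaIsoTw σ' (Fin.append c e) (Fin.append c' e') ∧
        IsStrong (coreΛ ⊔ Submodule.span ℚ (range (Fin.append c' e'))) := by
  sorry

/-- **stub_corePoints** (S3; THE LOAD-BEARING STUB of this line; open in general, the rank-one
Kummer-generic sector provable now modulo S4 — `RankOnePartners`, §4): `CorePoints`. -/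
theorem stub_corePoints :
    IsStrong coreΛ → ∀ a : ℂ, a ∉ logFreeCore → ∀ X : Set ℂ, X.Finite →
      ∃ (σ : fieldOf coreΛ ≃+* fieldOf coreΛ) (k : ℕ) (e e' : Fin (k + 1) → ℂ),
        e 0 = a ∧ e' 0 ∉ X ∧ IsCoreTwist σ ∧ IsGammaIsoTw σ e e' ∧
        IsStrong (coreΛ ⊔ Submodule.span ℚ (range e)) ∧
        IsStrong (coreΛ ⊔ Submodule.span ℚ (range e')) := by
  sorry

/-- **stub_coreStrong** (S4; open, arithmetic — Schanuel's conjecture OVER the core, `C_EA ◁ ℂ_exp`):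
`CoreStrong`. -/
theorem stub_coreStrong : IsStrong coreΛ := by
  sorry

/-! ### §3 Composition (sorry-free) and the skeleton theorem -/

/-- **The five stubs imply the crux** in its unbundled form `acl^{ℂ_exp}(∅) ⊆ C_EA`
(`Negative.aclSubsetLogFreeCore_iff` is `Iff.rfl`).  Sorry-free: S3 (fed by S4) moves `a ∉ C_EA`
to a partner outside the finite definable set `S ∋ a` by a core state; S1 (fed by S2a, fed by S2b)
makes core states a back-and-forth family; Karp's lemma (`realize_iff_of_isBackAndForth`, tree) transfers the
parameter-free defining formula of `S`; contradiction. -/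
theorem composition (hK : CoreKarp) (hE : CoreSaturation → CoreExtension) (hSat : CoreSaturation)
    (hP : CorePoints) (hS : CoreStrong) : expAcl ⊆ (logFreeCore : Set ℂ) := by
  rintro a ⟨s, hsfin, hsdef, has⟩
  by_contra ha
  have ha' : a ∉ logFreeCore := ha
  obtain ⟨σ, k, e, e', he0, heX, hσ, hiso, hs₁, hs₂⟩ := hP hS a ha' s hsfin
  obtain ⟨φ, hφ⟩ := Set.empty_definable_iff.1 hsdef
  have hBF := hK (hE hSat) (Fin 1) (fun _ => a) (fun _ => e' 0)
  -- Karp's lemma for the parameter-free defining formula `φ` of `S` (variables = the valuation)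
  have key : φ.Realize (fun _ : Fin 1 => a) ↔ φ.Realize (fun _ : Fin 1 => e' 0) :=
    FirstOrder.Language.realize_iff_of_isBackAndForth hBF φ
      ⟨σ, k + 1, e, e', hσ, hiso, hs₁, hs₂, fun _ => ⟨0, he0, rfl⟩, fun i => i.elim0⟩
  have h1 : (fun _ : Fin 1 => a) ∈ {x : Fin 1 → ℂ | x 0 ∈ s} := has
  rw [hφ] at h1
  have h2 : (fun _ : Fin 1 => e' 0) ∈ setOf φ.Realize := key.1 h1
  have h3 : (fun _ : Fin 1 => e' 0) ∈ {x : Fin 1 → ℂ | x 0 ∈ s} := by rw [hφ]; exact h2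
  exact heX h3

/-- **The skeleton**: the crux `RigidCore.AclSubsetLogFreeCore` BY NAME, modulo exactly the five
registered stubs. -/
theorem AclSubsetLogFreeCore_of : Summit.Schanuel.Schanuel.Theses.RigidCore.AclSubsetLogFreeCore :=
  aclSubsetLogFreeCore_iff.mpr
    (composition stub_coreKarp stub_coreExtension stub_coreSaturation stub_corePoints stub_coreStrong)

/-! ### §4 Named targets for the lead (first deliverables toward S3; statements only, no sorry) -/

/-- **Pólya / Hadamard two-frequency theorem** (analytic input of the rank-one sector of S3; Pólya,
Math. Z. 1920; Levin, *Distribution of zeros of entire functions*, Ch. VI; also a 5-line consequence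
of Hadamard factorisation, not in Mathlib — to be vendored as a Literature fact): a one-variable
exponential polynomial `∑ⱼ Pⱼ(z) e^{μⱼ z}` with pairwise distinct integer frequencies and at least
two non-zero coefficients has infinitely many complex zeros.  (Verbatim the ideator's statement.) -/
def PolyaTwoFrequencies : Prop :=
  ∀ (m : ℕ) (P : Fin m → Polynomial ℂ) (μ : Fin m → ℤ), Function.Injective μ →
    2 ≤ (Finset.univ.filter fun j => P j ≠ 0).card →
    Set.Infinite {z : ℂ | ∑ j, (P j).eval z * Complex.exp ((μ j : ℂ) * z) = 0}

/-- **The card's first lemma, `∃`-layer form** (unconditional modulo `PolyaTwoFrequencies`; size M):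
no existential `∅`-formula with core-plus-rational-multiple ("rank-one") witnesses isolates finitely
many points around a point outside the core — the projection of `W ∩ Γ` to the first coordinate is
infinite.  Settles (A) for finite sets defined by such formulas WITHOUT S2a/S2b/S4; recorded as the
lead's cheapest landing (it is the `∃`-shadow of `RankOnePartners`). -/
def CoreUnaryWitnessesInfinite : Prop :=
  ∀ (n : ℕ) (W : Set (Fin (n + 1) ⊕ Fin (n + 1) → ℂ)),
    IsDefinedOver (⊥ : Subfield ℂ) W →
    ∀ a : ℂ, a ∉ logFreeCore →
    ∀ p : Fin (n + 1) → ℂ, Sum.elim p (Complex.exp ∘ p) ∈ W →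
      (∀ i, ∃ k ∈ logFreeCore, ∃ q : ℚ, p i = k + (q : ℂ) * a) → p 0 ∉ logFreeCore →
      Set.Infinite {x : ℂ | ∃ y : Fin (n + 1) → ℂ, y 0 = x ∧ Sum.elim y (Complex.exp ∘ y) ∈ W}

/-- **Rank-one, Kummer-generic sector of S3** (provable now modulo `CoreStrong`; size M/L): if
`a ∉ C_EA` is a zero of `F(z, e^z)` for a polynomial `F` over `ℂ` with coefficients in the core, of
positive degree in BOTH variables, all of whose level curves `F(x, y^M) = 0` (`M ≥ 1`) are
irreducible (Kummer-genericity; the core is an algebraically closed field, so irreducible =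
absolutely irreducible), and `F(z, e^z)` has infinitely many zeros OUTSIDE the core (infinitely many
zeros is `PolyaTwoFrequencies`; that infinitely many of them avoid the countable core is the
absorption question, kept as a hypothesis — it is where arithmetic could enter even in rank one),
then for every finite `X` there is a zero `a' ∉ X` with `![a] ↦ ![a']` an UNtwisted core state:
`(a', e^{a'/M!})` and `(a, e^{a/M!})` are generic points of the same irreducible level curve
(generic = not a `C_EA`-point, i.e. `a' ∉ C_EA`), and `δ(a/C_EA) = δ(a'/C_EA) = 0` makes both
extensions strong (Bays–Kirby Lemma 4.8, `IsStrong.of_predim_eq_zero`).  Instances: fixed points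
of `exp` (`F = y − x`), `z e^z = 1` (`F = x y − 1`) — the route header's "fixed-point
indiscernibility ⇒ Marker's corollary" row. -/
def RankOnePartners : Prop :=
  IsStrong coreΛ → ∀ (F : MvPolynomial (Fin 2) ℂ), (∀ i, F.coeff i ∈ logFreeCore) →
    0 < F.degreeOf 0 → 0 < F.degreeOf 1 →
    (∀ M : ℕ, 0 < M → Irreducible
      (MvPolynomial.bind₁ (![MvPolynomial.X 0, MvPolynomial.X 1 ^ M] : Fin 2 → MvPolynomial (Fin 2) ℂ) F)) →
    Set.Infinite {z : ℂ | MvPolynomial.aeval ![z, Complex.exp z] F = 0 ∧ z ∉ logFreeCore} →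
    ∀ a : ℂ, a ∉ logFreeCore → MvPolynomial.aeval ![a, Complex.exp a] F = 0 →
    ∀ X : Set ℂ, X.Finite → ∃ a' : ℂ, a' ∉ X ∧
      IsGammaIsoTw (RingEquiv.refl (fieldOf coreΛ)) ![a] ![a'] ∧
      IsStrong (coreΛ ⊔ Submodule.span ℚ (range ![a])) ∧ IsStrong (coreΛ ⊔ Submodule.span ℚ (range ![a']))

end Summit.Schanuel.Schanuel.Cruxes.AclSubsetLogFreeCore.PointsNotAutomorphisms

end
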